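import Literature.NumberTheory.EllipticCurves.NeronLocalHeightDecompositionProofs
import Literature.NumberTheory.EllipticCurves.VariableChangePoints
import HarnessLib

/-!
# Tate's `λ` does not depend on the Weierstrass equation (ATAEC Thm. VI.1.1(b))

Topic `NumberTheory/EllipticCurves` (family `abc`, G06). Pure proofs, no definitions and no named
facts. Silverman, *Advanced Topics in the Arithmetic of Elliptic Curves*, Thm. VI.1.1(b)
(PDF p. 419): *"`λ` is independent of the choice of Weierstrass equation for `E/K`"* — for the
Néron local height in Silverman's normalisation (the `−(1/12)v(Δ)` built into (ii)–(iii)). We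
prove it for **Tate's series** `λ = λ₁ + μ` (`WeierstrassCurve.Affine.Point.neronLocalHeight`,
file `NeronLocalHeight.lean`) over any field `K` with `2 ≠ 0` and any real absolute value `v`,
along the isomorphism of point groups `W(K) ≃+ (C • W)(K)` induced by an admissible change of
variables `C = (u, r, s, t)` (`WeierstrassCurve.VariableChange.pointEquiv`,
file `VariableChangePoints.lean`): `λ_{C • W}(C · P) = λ_W(P)` for `P ≠ O`
(`neronLocalHeight_pointEquiv`).

## Proof (the uniqueness argument of ATAEC VI.1.1, run on the group `W(K)`)

`g(P) = λ'(C·P) − λ(P)` is bounded on `W(K)`: `μ, μ'` are bounded by Tate's Lemma VI.1.2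
(`tateCorrection_bounded_of_two_ne_zero`, `abs_tateMu_le_of`) and
`λ₁'(C·P) − λ₁(P) = ½log⁺|u⁻²(x − r)| − ½log⁺|x|` is bounded (`posLog` estimates). By the
duplication formula VI.1.1(a)(iii) for both equations (`neronLocalHeight_two_nsmul_of`) and the
transformation rules `2y' + a₁'x' + a₃' = u⁻³(2y + a₁x + a₃)`, `Δ' = u⁻¹²Δ`
(`two_mul_toY_add`, Mathlib `variableChange_Δ`), `g(2P) = 4g(P)` whenever `2P ≠ O`; hence
`g(P) = 4⁻ᵏg(2ᵏP) → 0` if no `2ᵏP` vanishes. If `P ≠ O` has `2`-power order, `2^{m−1}P = Q` has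
order `2` and `g(P) = 4^{1−m}g(Q)`, and `g(Q) = 0` by the closed form
`λ(Q) = ⅛log|φ₂(x(Q))| − (1/12)log|Δ|` (`neronLocalHeight_of_two_torsion`) and
`φ₂'(x') = u⁻⁸(φ₂(x) − rψ₂²(x))` (`eval_Φ_two_toX`; `ψ₂²(x(Q)) = 0`).

## References

* J. H. Silverman, *Advanced Topics in the Arithmetic of Elliptic Curves*, GTM 151 (1994),
  Thm. VI.1.1 and its proof (PDF pp. 419–422).
* J. H. Silverman, *The Arithmetic of Elliptic Curves*, 2nd ed. (2009), III.1, Table 3.1.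
-/

noncomputable section

open scoped Classical

open Polynomial

namespace WeierstrassCurve.Affine.Point

variable {K : Type*} [Field K] (v : AbsoluteValue K ℝ) {W : WeierstrassCurve K}
  (C : WeierstrassCurve.VariableChange K)

/-! ### Transformation rules -/

/-- `2y' + a₁'x' + a₃' = u⁻³(2y + a₁x + a₃)` under `(x, y) ↦ (u⁻²(x − r), u⁻³(y − s(x − r) − t))`
(Silverman, *AEC*, III.1, Table 3.1). [cite: SilvermanAEC2009, III.1 Table 3.1] -/
theorem two_mul_toY_add (x y : K) :
    2 * C.toY x y + (C • W).a₁ * C.toX x + (C • W).a₃ =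
      (↑C.u⁻¹ : K) ^ 3 * (2 * y + W.a₁ * x + W.a₃) := by
  simp only [WeierstrassCurve.VariableChange.toX, WeierstrassCurve.VariableChange.toY,
    variableChange_a₁, variableChange_a₃]
  ring

/-- `φ₂'(x') = u⁻⁸(φ₂(x) − r ψ₂²(x))` for `x' = u⁻²(x − r)` (from the transformation of the
`bᵢ`, Silverman, *AEC*, III.1, Table 3.1). [cite: SilvermanAEC2009, III.1 Table 3.1] -/
theorem eval_Φ_two_toX (x : K) :
    ((C • W).Φ 2).eval (C.toX x) =
      (↑C.u⁻¹ : K) ^ 8 * ((W.Φ 2).eval x - C.r * W.Ψ₂Sq.eval x) := by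
  rw [eval_Φ_two, eval_Φ_two, eval_Ψ₂Sq, variableChange_b₄, variableChange_b₆, variableChange_b₈,
    WeierstrassCurve.VariableChange.toX_def]
  ring

/-! ### `λ₁' − λ₁` is bounded -/

/-- `log⁺|u⁻²(x − r)| − log⁺|x|` is bounded above and below on `K` (elementary `log⁺`
estimates: `log⁺(ab) ≤ log⁺a + log⁺b`, `log⁺(a + b) ≤ log 2 + log⁺a + log⁺b`). [folklore] -/
theorem abs_posLog_toX_sub_posLog_le (x : K) :
    |Real.posLog (v (C.toX x)) - Real.posLog (v x)| ≤
      Real.posLog (v (↑C.u⁻¹ : K) ^ 2) + Real.posLog (v (C.u : K) ^ 2) + Real.log 2 +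
        Real.posLog (v C.r) := by
  have h0 := Real.posLog_nonneg (x := v (↑C.u⁻¹ : K) ^ 2)
  have h0' := Real.posLog_nonneg (x := v (C.u : K) ^ 2)
  have h0r := Real.posLog_nonneg (x := v C.r)
  have hlog2 : 0 ≤ Real.log 2 := Real.log_nonneg one_le_two
  rw [abs_le]
  constructor
  · -- `x = u² x' + r`
    have hx : x = (C.u : K) ^ 2 * C.toX x + C.r := (C.ofX_toX x).symm
    have h1 : Real.posLog (v x) ≤ Real.log 2 + Real.posLog (v ((C.u : K) ^ 2 * C.toX x)) +
        Real.posLog (v C.r) := by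
      calc Real.posLog (v x) = Real.posLog (v ((C.u : K) ^ 2 * C.toX x + C.r)) := by rw [← hx]
        _ ≤ Real.posLog (v ((C.u : K) ^ 2 * C.toX x) + v C.r) :=
            Real.posLog_le_posLog (v.nonneg _) (v.add_le _ _)
        _ ≤ _ := Real.posLog_add
    have h2 : Real.posLog (v ((C.u : K) ^ 2 * C.toX x)) ≤
        Real.posLog (v (C.u : K) ^ 2) + Real.posLog (v (C.toX x)) := by
      rw [v.map_mul, v.map_pow]
      exact Real.posLog_mul
    linarith
  · have hx : C.toX x = (↑C.u⁻¹ : K) ^ 2 * (x - C.r) := C.toX_def x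
    have h1 : Real.posLog (v (C.toX x)) ≤
        Real.posLog (v (↑C.u⁻¹ : K) ^ 2) + Real.posLog (v (x - C.r)) := by
      rw [hx, v.map_mul, v.map_pow]
      exact Real.posLog_mul
    have h2 : Real.posLog (v (x - C.r)) ≤ Real.log 2 + Real.posLog (v x) + Real.posLog (v C.r) := by
      calc Real.posLog (v (x - C.r)) ≤ Real.posLog (v x + v C.r) := by
            refine Real.posLog_le_posLog (v.nonneg _) ?_
            calc v (x - C.r) = v (x + -C.r) := by rw [sub_eq_add_neg]
              _ ≤ v x + v (-C.r) := v.add_le _ _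
              _ = v x + v C.r := by rw [v.map_neg]
        _ ≤ _ := Real.posLog_add
    linarith

/-- `|λ₁'(C·P) − λ₁(P)| ≤ B₁` on `W(K)`. [folklore] -/
theorem abs_naiveLocalHeight_pointEquiv_sub_le (P : W.toAffine.Point) :
    |naiveLocalHeight v (WeierstrassCurve.VariableChange.pointEquiv W C P) - naiveLocalHeight v P| ≤
      1 / 2 * (Real.posLog (v (↑C.u⁻¹ : K) ^ 2) + Real.posLog (v (C.u : K) ^ 2) + Real.log 2 +
        Real.posLog (v C.r)) := by
  rcases P with _ | ⟨x, y, h⟩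
  · show |naiveLocalHeight v (WeierstrassCurve.VariableChange.pointEquiv W C 0) -
        naiveLocalHeight v 0| ≤ _
    rw [WeierstrassCurve.VariableChange.pointEquiv_zero, naiveLocalHeight_zero, naiveLocalHeight_zero,
      sub_zero, abs_zero]
    have h0 := Real.posLog_nonneg (x := v (↑C.u⁻¹ : K) ^ 2)
    have h0' := Real.posLog_nonneg (x := v (C.u : K) ^ 2)
    have h0r := Real.posLog_nonneg (x := v C.r)
    have hlog2 : 0 ≤ Real.log 2 := Real.log_nonneg one_le_two
    positivity
  · rw [WeierstrassCurve.VariableChange.pointEquiv_some, naiveLocalHeight_some,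
      naiveLocalHeight_some, ← mul_sub, abs_mul, abs_of_pos (by norm_num : (0 : ℝ) < 1 / 2)]
    exact mul_le_mul_of_nonneg_left (abs_posLog_toX_sub_posLog_le v C x) (by norm_num)

/-! ### The difference `λ'(C·P) − λ(P)` -/

/-- **`g = λ' ∘ C − λ` is bounded on `W(K)`** (`char K ≠ 2`): `μ`, `μ'` are bounded
(Tate's Lemma VI.1.2) and `λ₁' − λ₁` is bounded. [cite: Silverman1994, Thm VI.1.1(a)] -/
theorem exists_abs_neronLocalHeight_pointEquiv_sub_le [W.IsElliptic] (h2K : (2 : K) ≠ 0) :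
    ∃ B : ℝ, ∀ P : W.toAffine.Point,
      |neronLocalHeight v (WeierstrassCurve.VariableChange.pointEquiv W C P) -
        neronLocalHeight v P| ≤ B := by
  obtain ⟨C₁, hC₁⟩ := tateCorrection_bounded_of_two_ne_zero v W h2K
  obtain ⟨C₂, hC₂⟩ := tateCorrection_bounded_of_two_ne_zero v (C • W) h2K
  set B₁ := 1 / 2 * (Real.posLog (v (↑C.u⁻¹ : K) ^ 2) + Real.posLog (v (C.u : K) ^ 2) +
    Real.log 2 + Real.posLog (v C.r)) with hB₁
  refine ⟨B₁ + C₂ / 3 + C₁ / 3, fun P => ?_⟩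
  have h1 := abs_naiveLocalHeight_pointEquiv_sub_le v C P
  have h2 := abs_tateMu_le_of v hC₁ P
  have h3 := abs_tateMu_le_of v hC₂ (WeierstrassCurve.VariableChange.pointEquiv W C P)
  rw [neronLocalHeight, neronLocalHeight]
  calc |naiveLocalHeight v (WeierstrassCurve.VariableChange.pointEquiv W C P) +
        tateMu v (WeierstrassCurve.VariableChange.pointEquiv W C P) -
        (naiveLocalHeight v P + tateMu v P)|
      = |(naiveLocalHeight v (WeierstrassCurve.VariableChange.pointEquiv W C P) -
          naiveLocalHeight v P) +
          tateMu v (WeierstrassCurve.VariableChange.pointEquiv W C P) + (-tateMu v P)| := by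
        ring_nf
    _ ≤ |naiveLocalHeight v (WeierstrassCurve.VariableChange.pointEquiv W C P) -
          naiveLocalHeight v P| +
          |tateMu v (WeierstrassCurve.VariableChange.pointEquiv W C P)| + |-tateMu v P| :=
        abs_add_three _ _ _
    _ ≤ B₁ + C₂ / 3 + C₁ / 3 := by rw [abs_neg]; gcongr

/-- **`g(2P) = 4g(P)` for `2P ≠ O`**: the duplication formula VI.1.1(a)(iii) for both equations
and `v(2y' + a₁'x' + a₃') − ¼v(Δ') = v(2y + a₁x + a₃) − ¼v(Δ)` (`u⁻³` against `u⁻¹²`).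
[cite: Silverman1994, Thm VI.1.1(a)(iii)] -/
theorem neronLocalHeight_pointEquiv_two_nsmul_sub [W.IsElliptic] (h2K : (2 : K) ≠ 0)
    {P : W.toAffine.Point} (h2 : (2 : ℕ) • P ≠ 0) :
    neronLocalHeight v (WeierstrassCurve.VariableChange.pointEquiv W C ((2 : ℕ) • P)) -
        neronLocalHeight v ((2 : ℕ) • P) =
      4 * (neronLocalHeight v (WeierstrassCurve.VariableChange.pointEquiv W C P) -
        neronLocalHeight v P) := by
  rcases P with _ | ⟨x, y, h⟩
  · exact absurd (nsmul_zero _) h2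
  · have hW := neronLocalHeight_two_nsmul_of v (tateCorrection_bounded_of_two_ne_zero v W h2K) h h2
    set h' := (WeierstrassCurve.VariableChange.nonsingular_iff W C x y).mpr h with hh'
    have hP' : WeierstrassCurve.VariableChange.pointEquiv W C (.some x y h) =
        .some (C.toX x) (C.toY x y) h' := WeierstrassCurve.VariableChange.pointEquiv_some W C h
    have h2' : (2 : ℕ) • (Point.some (C.toX x) (C.toY x y) h') ≠ 0 := by
      rw [← hP', ← map_nsmul]
      exact fun h0 => h2 ((WeierstrassCurve.VariableChange.pointEquiv W C).map_eq_zero_iff.mp h0)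
    have hW' := neronLocalHeight_two_nsmul_of v
      (tateCorrection_bounded_of_two_ne_zero v (C • W) h2K) h' h2'
    rw [map_nsmul, hP', hW', hW, two_mul_toY_add, variableChange_Δ]
    have hu : v (↑C.u⁻¹ : K) ≠ 0 := v.ne_zero_iff.mpr (Units.ne_zero _)
    have hu0 : 0 < v (↑C.u⁻¹ : K) := v.pos (Units.ne_zero _)
    have hD : 2 * y + W.a₁ * x + W.a₃ ≠ 0 := by
      have hy : y ≠ W.toAffine.negY x y := (two_nsmul_some_ne_zero_iff h).mp h2
      intro h0
      apply hy
      rw [WeierstrassCurve.Affine.negY]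
      linear_combination h0
    have hΔ : v W.Δ ≠ 0 := v.ne_zero_iff.mpr W.isUnit_Δ.ne_zero
    rw [v.map_mul, v.map_mul, v.map_pow, v.map_pow, Real.log_mul (pow_ne_zero _ hu)
      (v.ne_zero_iff.mpr hD), Real.log_mul (pow_ne_zero _ hu) hΔ, Real.log_pow, Real.log_pow]
    push_cast
    ring

/-- `g(2ᵏP) = 4ᵏg(P)` as long as `2ᵏP ≠ O`. [cite: Silverman1994, Thm VI.1.1(a)(iii)] -/
theorem neronLocalHeight_pointEquiv_two_pow_nsmul_sub [W.IsElliptic] (h2K : (2 : K) ≠ 0)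
    {P : W.toAffine.Point} (k : ℕ) (hk : (2 ^ k : ℕ) • P ≠ 0) :
    neronLocalHeight v (WeierstrassCurve.VariableChange.pointEquiv W C ((2 ^ k : ℕ) • P)) -
        neronLocalHeight v ((2 ^ k : ℕ) • P) =
      4 ^ k * (neronLocalHeight v (WeierstrassCurve.VariableChange.pointEquiv W C P) -
        neronLocalHeight v P) := by
  induction k with
  | zero => simp
  | succ k ih =>
    have hk' : (2 ^ k : ℕ) • P ≠ 0 := by
      intro h0
      apply hk
      rw [pow_succ', ← smul_smul, h0, smul_zero]
    have h2 : (2 : ℕ) • ((2 ^ k : ℕ) • P) ≠ 0 := by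
      rwa [smul_smul, ← pow_succ']
    rw [show (2 ^ (k + 1) : ℕ) • P = (2 : ℕ) • ((2 ^ k : ℕ) • P) by
      rw [smul_smul, ← pow_succ'],
      neronLocalHeight_pointEquiv_two_nsmul_sub v C h2K h2, ih hk', pow_succ]
    ring

/-- **`g(Q) = 0` at a point of order `2`** (`char K ≠ 2`): both local heights are given by the
closed form `⅛log|φ₂(x(Q))| − (1/12)log|Δ|` (`neronLocalHeight_of_two_torsion`), and
`φ₂'(x') = u⁻⁸φ₂(x)` at such a point (`ψ₂²(x(Q)) = 0`), `Δ' = u⁻¹²Δ`.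
[cite: Silverman1994, Thm VI.1.1(b)] -/
theorem neronLocalHeight_pointEquiv_of_two_torsion [W.IsElliptic] (h2K : (2 : K) ≠ 0) {x y : K}
    (h : W.toAffine.Nonsingular x y) (hy : y = W.toAffine.negY x y) :
    neronLocalHeight v (WeierstrassCurve.VariableChange.pointEquiv W C (.some x y h)) =
      neronLocalHeight v (.some x y h) := by
  set h' := (WeierstrassCurve.VariableChange.nonsingular_iff W C x y).mpr h with hh'
  have hP' : WeierstrassCurve.VariableChange.pointEquiv W C (.some x y h) =
      .some (C.toX x) (C.toY x y) h' := WeierstrassCurve.VariableChange.pointEquiv_some W C h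
  have hy' : C.toY x y = (C • W).toAffine.negY (C.toX x) (C.toY x y) := by
    have h2 : (2 : ℕ) • (Point.some x y h) = 0 := by rw [two_nsmul, add_self_of_Y_eq hy]
    have h2' : (2 : ℕ) • (Point.some (C.toX x) (C.toY x y) h') = 0 := by
      rw [← hP', ← map_nsmul, h2, WeierstrassCurve.VariableChange.pointEquiv_zero]
    by_contra hne
    exact ((two_nsmul_some_ne_zero_iff h').mpr hne) h2'
  obtain ⟨hφ, hl⟩ := neronLocalHeight_of_two_torsion v h2K h hy
  obtain ⟨-, hl'⟩ := neronLocalHeight_of_two_torsion v h2K h' hy'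
  have hψ : W.Ψ₂Sq.eval x = 0 := by
    have hyy : y - W.toAffine.negY x y = 0 := sub_eq_zero.mpr hy
    rw [← sub_negY_sq_eq_eval_Ψ₂Sq h.1, hyy, zero_pow two_ne_zero]
  rw [hP', hl', hl, eval_Φ_two_toX, hψ, mul_zero, sub_zero, variableChange_Δ]
  have hu : v (↑C.u⁻¹ : K) ≠ 0 := v.ne_zero_iff.mpr (Units.ne_zero _)
  have hΔ : v W.Δ ≠ 0 := v.ne_zero_iff.mpr W.isUnit_Δ.ne_zero
  rw [v.map_mul, v.map_mul, v.map_pow, v.map_pow, Real.log_mul (pow_ne_zero _ hu)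
    (v.ne_zero_iff.mpr hφ), Real.log_mul (pow_ne_zero _ hu) hΔ, Real.log_pow, Real.log_pow]
  push_cast
  ring

/-- **ATAEC Thm. VI.1.1(b) for Tate's series: `λ` does not depend on the Weierstrass equation.**
For an elliptic curve `W` over a field `K` with `2 ≠ 0`, a real absolute value `v`, and an
admissible change of variables `C`, the Néron local height (Tate's series `λ = λ₁ + μ`) of
`C • W` at the image `C·P = (u⁻²(x − r), u⁻³(y − s(x − r) − t))` of a point `P ≠ O` equals
that of `W` at `P`. [cite: Silverman1994, Thm VI.1.1(b)] -/
theorem neronLocalHeight_pointEquiv [W.IsElliptic] (h2K : (2 : K) ≠ 0) {P : W.toAffine.Point}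
    (hP : P ≠ 0) :
    neronLocalHeight v (WeierstrassCurve.VariableChange.pointEquiv W C P) = neronLocalHeight v P := by
  obtain ⟨B, hB⟩ := exists_abs_neronLocalHeight_pointEquiv_sub_le (W := W) v C h2K
  set g : W.toAffine.Point → ℝ := fun P =>
    neronLocalHeight v (WeierstrassCurve.VariableChange.pointEquiv W C P) - neronLocalHeight v P
    with hg
  have hB0 : 0 ≤ B := (abs_nonneg _).trans (hB 0)
  -- `g(P) = 0` as soon as no `2ᵏ P` vanishes
  have hfree : ∀ Q : W.toAffine.Point, (∀ k : ℕ, (2 ^ k : ℕ) • Q ≠ 0) → g Q = 0 := by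
    intro Q hQ
    by_contra hne
    have hpos : 0 < |g Q| := abs_pos.mpr hne
    have hbound : ∀ k : ℕ, |g Q| ≤ (1 / 4 : ℝ) ^ k * B := fun k => by
      have hk := neronLocalHeight_pointEquiv_two_pow_nsmul_sub v C h2K k (hQ k)
      have : g Q = (1 / 4 : ℝ) ^ k * g ((2 ^ k : ℕ) • Q) := by
        rw [hg]; dsimp only; rw [hk, ← mul_assoc, ← mul_pow]; norm_num
      rw [this, abs_mul, abs_of_nonneg (by positivity)]
      exact mul_le_mul_of_nonneg_left (hB _) (by positivity)
    rcases eq_or_lt_of_le hB0 with hB0' | hBpos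
    · have := hbound 0
      rw [← hB0', mul_zero] at this
      exact absurd this (not_le.mpr hpos)
    · obtain ⟨k, hk⟩ := exists_pow_lt_of_lt_one (div_pos hpos hBpos) (by norm_num : (1 / 4 : ℝ) < 1)
      have := hbound k
      rw [lt_div_iff₀ hBpos] at hk
      linarith
  suffices g P = 0 by
    rw [hg] at this
    dsimp only at this
    linarith
  by_cases htor : ∀ k : ℕ, (2 ^ k : ℕ) • P ≠ 0
  · exact hfree P htor
  · -- `P` has `2`-power order: go down to a point of order `2`
    push Not at htor
    have hex : ∃ k : ℕ, (2 ^ k : ℕ) • P = 0 := htor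
    let m := Nat.find hex
    have hm : (2 ^ m : ℕ) • P = 0 := Nat.find_spec hex
    have hm0 : m ≠ 0 := by
      intro h0
      rw [h0, pow_zero, one_nsmul] at hm
      exact hP hm
    obtain ⟨k, hk⟩ : ∃ k, m = k + 1 := ⟨m - 1, by omega⟩
    have hQ : (2 ^ k : ℕ) • P ≠ 0 := Nat.find_min hex (by omega)
    -- `Q = 2ᵏ P` has order `2`
    set Q := (2 ^ k : ℕ) • P with hQdef
    have h2Q : (2 : ℕ) • Q = 0 := by
      rw [hQdef, smul_smul, ← pow_succ', ← hk]; exact hm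
    have hgQ : g Q = 0 := by
      rcases Q with _ | ⟨x, y, h⟩
      · exact absurd rfl hQ
      · have hy : y = W.toAffine.negY x y := by
          by_contra hne
          exact ((two_nsmul_some_ne_zero_iff h).mpr hne) h2Q
        rw [hg]; dsimp only
        rw [neronLocalHeight_pointEquiv_of_two_torsion v C h2K h hy, sub_self]
    have hk' := neronLocalHeight_pointEquiv_two_pow_nsmul_sub v C h2K k hQ
    have : g Q = 4 ^ k * g P := hk'
    rw [hgQ] at this
    have h4 : (4 : ℝ) ^ k ≠ 0 := pow_ne_zero _ (by norm_num)
    exact (mul_eq_zero.mp this.symm).resolve_left h4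

end WeierstrassCurve.Affine.Point

end
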